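import Summits.Ventures.CertifiedManyBodySolver.Downfold.EmeryBoxesLa214JetCellX0T6
import Summits.Ventures.CertifiedManyBodySolver.Downfold.EmeryBoxesLa214JetCellX0T7
import Summits.Ventures.CertifiedManyBodySolver.Downfold.EmeryBoxesLa214JetCellX0T8
import Summits.Ventures.CertifiedManyBodySolver.Downfold.EmeryFermiFillingLa214
import HarnessLib

/-!
# THE TIGHT OBJECT-M WINDOWS of box #18 (La₂CuO₄, x = 0) — ASSEMBLED over the 8×4×2 cell grid with two-corner K = 384 ε_F brackets, solver-level Δ_pd tag [3.24, 4.0]: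
# `(t_J, t′_J/t_J, t″_J/t_J)` of the nodal 2-jet at ε_F for EVERY member (INFL-3to1-B §B.101 (c))

Venture CertifiedManyBodySolver, cell `pub/hubbard-downfold` (stage S1; INFLATION-RULES-3to1-B §B.101 (c)), seat hubbard-downfold-mod-4 (technique B = band
level, g45); namespace `Summit.Ventures.CertifiedManyBodySolver.Downfold.Emery`. Everything PROVED (`decide +kernel`). THE TIGHT VARIANT of `EmeryBoxesLa214JetWindowX0`: the typed box
`emeryBoxLa214v123` (Δ_pd [1.7, 4.0] × t_pd [1.29, 1.52] × t_pp [0.46, 0.66] × t_pp′ [0.12, 0.15] eV) is cut into 8 × 4 × 2 cells (Δ_pd × t_pd × t_pp; t_pp′ whole);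
on each cell the member's ε_F(ν = ½) lies between ε_F at the cell's LOW corner (Δ₂, a₁, b₁, c₂) and at its HIGH corner (Δ₁, a₂, b₂, c₁)
(`fermiEnergyOf_mem_Icc_of_mem_box'`, the two-corner rule), each cornered by a K = 384 `pointBracketCheck` (`fermiEnergyOf_of_pointBracketCheck`; brackets of
half-width ≈ 0.005–0.008 eV, generator scale-g36/gen/brackets.py); the nodal-jet windows are then certified on (cell × [e₁(L), e₂(H)]) by the slope-arithmetic
device (`EmeryBandJetWindow.jetWindow_of_deep`, margin 0.005). WHAT THIS IS NOT: a statement about La₂CuO₄ (SCREENING-GRADE box); `U = 0` σ kinematics;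
still an OUTER bound (per-cell ε_F coupling, cell bracket widths 0.10–0.25 eV instead of the sub-box 0.5–0.8 eV).

| Δ_pd range | TIGHT window (this file) | sub-box window (`EmeryBoxesLa214JetWindowX0`) | float truth |
|---|---|---|---|
| whole Δ_pd hull [1.7, 4.0] | t_J [0.2943, 0.5063] eV, t′_J/t_J [-0.1017, 0.0066], t″_J/t_J [0.0552, 0.1701] | t′_J/t_J [−0.1162, 0.0347], t″_J/t_J [0.0373, 0.2372] | t′/t [−0.090, −0.012], t″/t [0.072, 0.130] |
| DFT-level Δ_pd tag [1.7, 2.91] | t_J [0.3224, 0.5063] eV, t′_J/t_J [-0.0989, 0.0066], t″_J/t_J [0.0663, 0.1701] | t′_J/t_J [−0.1133, 0.0347], t″_J/t_J [0.0447, 0.2372] | — |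
| solver-level Δ_pd tag [3.24, 4.0] | t_J [0.2943, 0.4605] eV, t′_J/t_J [-0.1017, -0.0030], t″_J/t_J [0.0552, 0.1249] | t′_J/t_J [−0.1162, 0.0143], t″_J/t_J [0.0373, 0.1586] | — |

Sources: [HybertsenSchluterChristensen1989, Eq. (1)]; [AndersenEtAl1995, §6]; [PavariniEtAl2001, Eq. (1)]; interval/slope arithmetic [folklore].
-/

noncomputable section

namespace Summit.Ventures.CertifiedManyBodySolver.Downfold.Emery

open Real Set Literature.Analysis.ValidatedNumerics.Numerics

/-- **box #18 `emeryBoxLa214v123`, solver-level Δ_pd tag [3.24, 4.0], x = 0 — TIGHT (two-corner cells)**: for EVERY member, with ε = ε_F(θ) and x₀ = xNode(ε_F):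
`t_J [0.2943, 0.4605] eV, t′_J/t_J [-0.1017, -0.0030], t″_J/t_J [0.0552, 0.1249]`. [folklore] -/
theorem la214SOLBox_jetWindowCells_x0 {Δ a b c : ℝ} (hΔ : Δ ∈ Icc (81 / 25 : ℝ) (4 : ℝ)) (ha : a ∈ Icc (129 / 100 : ℝ) (38 / 25 : ℝ))
    (hb : b ∈ Icc (23 / 50 : ℝ) (33 / 50 : ℝ)) (hc : c ∈ Icc (3 / 25 : ℝ) (3 / 20 : ℝ)) :
    jetT Δ a b c (xNode Δ a b c (fermiEnergyOf Δ a b c (1 / 2 : ℝ))) (fermiEnergyOf Δ a b c (1 / 2 : ℝ)) ∈ Icc (2943 / 10000 : ℝ) (921 / 2000 : ℝ) ∧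
      jetTp Δ a b c (xNode Δ a b c (fermiEnergyOf Δ a b c (1 / 2 : ℝ))) (fermiEnergyOf Δ a b c (1 / 2 : ℝ)) / jetT Δ a b c (xNode Δ a b c (fermiEnergyOf Δ a b c (1 / 2 : ℝ))) (fermiEnergyOf Δ a b c (1 / 2 : ℝ)) ∈ Icc (-1017 / 10000 : ℝ) (-3 / 1000 : ℝ) ∧
      jetTpp Δ a b c (xNode Δ a b c (fermiEnergyOf Δ a b c (1 / 2 : ℝ))) (fermiEnergyOf Δ a b c (1 / 2 : ℝ)) / jetT Δ a b c (xNode Δ a b c (fermiEnergyOf Δ a b c (1 / 2 : ℝ))) (fermiEnergyOf Δ a b c (1 / 2 : ℝ)) ∈ Icc (69 / 1250 : ℝ) (1249 / 10000 : ℝ) := by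
  rcases mem_Icc_split hΔ (137 / 40 : ℝ) with hΔ | hΔ
  · rcases mem_Icc_split ha (281 / 200 : ℝ) with ha' | ha'
    · rcases mem_Icc_split ha' (539 / 400 : ℝ) with ha' | ha'
      · rcases mem_Icc_split hb (14 / 25 : ℝ) with hb' | hb'
        · exact (la214X0Cell_5_0_0 (⟨le_trans (by norm_num) hΔ.1, hΔ.2.trans (by norm_num)⟩) ha' hb' hc).widen (by norm_num [SC]) (by norm_num [SC]) (by norm_num [SC])
            (by norm_num [SC]) (by norm_num [SC]) (by norm_num [SC])
        · exact (la214X0Cell_5_0_1 (⟨le_trans (by norm_num) hΔ.1, hΔ.2.trans (by norm_num)⟩) ha' hb' hc).widen (by norm_num [SC]) (by norm_num [SC]) (by norm_num [SC])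
            (by norm_num [SC]) (by norm_num [SC]) (by norm_num [SC])
      · rcases mem_Icc_split hb (14 / 25 : ℝ) with hb' | hb'
        · exact (la214X0Cell_5_1_0 (⟨le_trans (by norm_num) hΔ.1, hΔ.2.trans (by norm_num)⟩) ha' hb' hc).widen (by norm_num [SC]) (by norm_num [SC]) (by norm_num [SC])
            (by norm_num [SC]) (by norm_num [SC]) (by norm_num [SC])
        · exact (la214X0Cell_5_1_1 (⟨le_trans (by norm_num) hΔ.1, hΔ.2.trans (by norm_num)⟩) ha' hb' hc).widen (by norm_num [SC]) (by norm_num [SC]) (by norm_num [SC])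
            (by norm_num [SC]) (by norm_num [SC]) (by norm_num [SC])
    · rcases mem_Icc_split ha' (117 / 80 : ℝ) with ha' | ha'
      · rcases mem_Icc_split hb (14 / 25 : ℝ) with hb' | hb'
        · exact (la214X0Cell_5_2_0 (⟨le_trans (by norm_num) hΔ.1, hΔ.2.trans (by norm_num)⟩) ha' hb' hc).widen (by norm_num [SC]) (by norm_num [SC]) (by norm_num [SC])
            (by norm_num [SC]) (by norm_num [SC]) (by norm_num [SC])
        · exact (la214X0Cell_5_2_1 (⟨le_trans (by norm_num) hΔ.1, hΔ.2.trans (by norm_num)⟩) ha' hb' hc).widen (by norm_num [SC]) (by norm_num [SC]) (by norm_num [SC])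
            (by norm_num [SC]) (by norm_num [SC]) (by norm_num [SC])
      · rcases mem_Icc_split hb (14 / 25 : ℝ) with hb' | hb'
        · exact (la214X0Cell_5_3_0 (⟨le_trans (by norm_num) hΔ.1, hΔ.2.trans (by norm_num)⟩) ha' hb' hc).widen (by norm_num [SC]) (by norm_num [SC]) (by norm_num [SC])
            (by norm_num [SC]) (by norm_num [SC]) (by norm_num [SC])
        · exact (la214X0Cell_5_3_1 (⟨le_trans (by norm_num) hΔ.1, hΔ.2.trans (by norm_num)⟩) ha' hb' hc).widen (by norm_num [SC]) (by norm_num [SC]) (by norm_num [SC])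
            (by norm_num [SC]) (by norm_num [SC]) (by norm_num [SC])
  · rcases mem_Icc_split hΔ (297 / 80 : ℝ) with hΔ | hΔ
    · rcases mem_Icc_split ha (281 / 200 : ℝ) with ha' | ha'
      · rcases mem_Icc_split ha' (539 / 400 : ℝ) with ha' | ha'
        · rcases mem_Icc_split hb (14 / 25 : ℝ) with hb' | hb'
          · exact (la214X0Cell_6_0_0 hΔ ha' hb' hc).widen (by norm_num [SC]) (by norm_num [SC]) (by norm_num [SC])
              (by norm_num [SC]) (by norm_num [SC]) (by norm_num [SC])
          · exact (la214X0Cell_6_0_1 hΔ ha' hb' hc).widen (by norm_num [SC]) (by norm_num [SC]) (by norm_num [SC])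
              (by norm_num [SC]) (by norm_num [SC]) (by norm_num [SC])
        · rcases mem_Icc_split hb (14 / 25 : ℝ) with hb' | hb'
          · exact (la214X0Cell_6_1_0 hΔ ha' hb' hc).widen (by norm_num [SC]) (by norm_num [SC]) (by norm_num [SC])
              (by norm_num [SC]) (by norm_num [SC]) (by norm_num [SC])
          · exact (la214X0Cell_6_1_1 hΔ ha' hb' hc).widen (by norm_num [SC]) (by norm_num [SC]) (by norm_num [SC])
              (by norm_num [SC]) (by norm_num [SC]) (by norm_num [SC])
      · rcases mem_Icc_split ha' (117 / 80 : ℝ) with ha' | ha'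
        · rcases mem_Icc_split hb (14 / 25 : ℝ) with hb' | hb'
          · exact (la214X0Cell_6_2_0 hΔ ha' hb' hc).widen (by norm_num [SC]) (by norm_num [SC]) (by norm_num [SC])
              (by norm_num [SC]) (by norm_num [SC]) (by norm_num [SC])
          · exact (la214X0Cell_6_2_1 hΔ ha' hb' hc).widen (by norm_num [SC]) (by norm_num [SC]) (by norm_num [SC])
              (by norm_num [SC]) (by norm_num [SC]) (by norm_num [SC])
        · rcases mem_Icc_split hb (14 / 25 : ℝ) with hb' | hb'
          · exact (la214X0Cell_6_3_0 hΔ ha' hb' hc).widen (by norm_num [SC]) (by norm_num [SC]) (by norm_num [SC])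
              (by norm_num [SC]) (by norm_num [SC]) (by norm_num [SC])
          · exact (la214X0Cell_6_3_1 hΔ ha' hb' hc).widen (by norm_num [SC]) (by norm_num [SC]) (by norm_num [SC])
              (by norm_num [SC]) (by norm_num [SC]) (by norm_num [SC])
    · rcases mem_Icc_split ha (281 / 200 : ℝ) with ha' | ha'
      · rcases mem_Icc_split ha' (539 / 400 : ℝ) with ha' | ha'
        · rcases mem_Icc_split hb (14 / 25 : ℝ) with hb' | hb'
          · exact (la214X0Cell_7_0_0 hΔ ha' hb' hc).widen (by norm_num [SC]) (by norm_num [SC]) (by norm_num [SC])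
              (by norm_num [SC]) (by norm_num [SC]) (by norm_num [SC])
          · exact (la214X0Cell_7_0_1 hΔ ha' hb' hc).widen (by norm_num [SC]) (by norm_num [SC]) (by norm_num [SC])
              (by norm_num [SC]) (by norm_num [SC]) (by norm_num [SC])
        · rcases mem_Icc_split hb (14 / 25 : ℝ) with hb' | hb'
          · exact (la214X0Cell_7_1_0 hΔ ha' hb' hc).widen (by norm_num [SC]) (by norm_num [SC]) (by norm_num [SC])
              (by norm_num [SC]) (by norm_num [SC]) (by norm_num [SC])
          · exact (la214X0Cell_7_1_1 hΔ ha' hb' hc).widen (by norm_num [SC]) (by norm_num [SC]) (by norm_num [SC])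
              (by norm_num [SC]) (by norm_num [SC]) (by norm_num [SC])
      · rcases mem_Icc_split ha' (117 / 80 : ℝ) with ha' | ha'
        · rcases mem_Icc_split hb (14 / 25 : ℝ) with hb' | hb'
          · exact (la214X0Cell_7_2_0 hΔ ha' hb' hc).widen (by norm_num [SC]) (by norm_num [SC]) (by norm_num [SC])
              (by norm_num [SC]) (by norm_num [SC]) (by norm_num [SC])
          · exact (la214X0Cell_7_2_1 hΔ ha' hb' hc).widen (by norm_num [SC]) (by norm_num [SC]) (by norm_num [SC])
              (by norm_num [SC]) (by norm_num [SC]) (by norm_num [SC])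
        · rcases mem_Icc_split hb (14 / 25 : ℝ) with hb' | hb'
          · exact (la214X0Cell_7_3_0 hΔ ha' hb' hc).widen (by norm_num [SC]) (by norm_num [SC]) (by norm_num [SC])
              (by norm_num [SC]) (by norm_num [SC]) (by norm_num [SC])
          · exact (la214X0Cell_7_3_1 hΔ ha' hb' hc).widen (by norm_num [SC]) (by norm_num [SC]) (by norm_num [SC])
              (by norm_num [SC]) (by norm_num [SC]) (by norm_num [SC])

end Summit.Ventures.CertifiedManyBodySolver.Downfold.Emery
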